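import Mathlib
import Summits.ValiantsHypothesis.ValiantsHypothesis.Theorems.RigidityForcesSymmetryRankRigidMinimalReprLaplaceFiveSeparatedCaptureEqualLinesMemTools
import Summits.ValiantsHypothesis.ValiantsHypothesis.Theorems.RigidityForcesSymmetryRankRigidMinimalReprLaplaceFiveSeparatedCaptureCoordSlices
import Summits.ValiantsHypothesis.ValiantsHypothesis.Theorems.RigidityForcesSymmetryRankRigidMinimalReprLaplaceFiveSeparatedCaptureLinesAnyThird

/-!
# ValiantsHypothesis / RigidityForcesSymmetry — crux `LaplaceOptimalFive` (stmt-ValiantsHypothesis-24813), symmetric capture (SC):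
# ★★★ **THE PROFILES `(1,1,r)`, `r ≤ 3`, OF `CaptureIneqSym` ARE THEOREMS** — equal lines inside their 3-space
# (`U₀₁ = U₀₂ = ℂu ≤ U₁₂`, `finrank U₁₂ = 3`) and the assembly `captureIneqSym_of_two_lines_le_three`

After ✓ `captureIneqSym_of_two_lines` (`finrank U₁₂ ≤ 2`), ✓ `captureIneqSym_of_nonproportional_lines_any` and
✓ `captureIneqSym_of_two_lines_any_of_not_mem` (LinesAnyThird), the profile `(1,1,3)` was open exactly at `ℂu = ℂu ≤ V := U₁₂`,
`finrank V = 3`, where `finrank W ≤ 5` is needed.  Case tree (`finrank_le_five_of_equal_lines_mem_three`):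
* `u` has a diagonal entry: ✓ `finrank_le_prolong_add_one_of_diag` + ✓ `finrank_prolong_le_four` ⇒ `≤ 5`;
* `u` zero-diagonal with ≥ 4 non-zero rows: ✓ `finrank_le_prolong_add_card_of_zeroDiag` with `|S| = 1` ⇒ `≤ 5`;
* exactly three non-zero rows: `|S| = 2` ⇒ `≤ finrank (prolong V) + 2`, fine unless `finrank (prolong V) = 4`; then the two
  COORDINATE SLICES at the free letters (✓ `sliceCoord_mem_01`, ✓ `finrank_le_of_two_slices`) land in `V ∩ Z_f`, each of finrank `≤ 2`
  because otherwise `V` is zero-diagonal and ✓ `finrank_prolong_le_three_of_zeroDiag` contradicts `finrank (prolong V) = 4`;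
* only two non-zero rows (a pair-supported line, e.g. `x_ab`): ✓ `finrank_le_five_of_pairLine_flat` (CoordSlices).
Results: ★★ `finrank_le_five_of_equal_lines_mem_three`, ★★ `captureIneqSym_of_equal_lines_mem_three`, ★★★
`captureIneqSym_of_two_lines_le_three`: `U₀₁ = ℂu₁`, `U₀₂ = ℂu₂` (`u₁, u₂ ≠ 0` symmetric, equal or not), `U₁₂` symmetric with
`finrank U₁₂ ≤ 3` ⇒ `finrank W ≤ finrank ℂu₁ + finrank ℂu₂ + finrank U₁₂`.

Honest framing.  One more profile family of an OPEN inequality: `CaptureIneqSym` in general (two spans of finrank ≥ 2 outside the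
closed cells; `(1,1,r)` with EQUAL lines and `r ≥ 4`; …), K1 on `K₃ ⊔ K₂`, S2′, `LaplaceOptimalFive` (stmt-24813, OPEN · CONTESTED
72/120), `RankRigidMinimalRepr`, `VP ≠ VNP` are NOT proved.  No definitions, no `sorry`; Mathlib + tree only.
-/

set_option linter.dupNamespace false
set_option autoImplicit false

namespace Summit.ValiantsHypothesis.ValiantsHypothesis.Theorems.RigidityForcesSymmetryRankRigidMinimalRepr

namespace LaplaceFiveSeparatedCapture

open Finset

/-! ### Equal lines inside their 3-space -/

/-- ★★ **EQUAL LINES INSIDE THEIR 3-SPACE: `finrank W ≤ 5`** for `(ℂu, ℂu, V)`, `u ∈ V`, `V` symmetric of `finrank 3`. [folklore] -/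
theorem finrank_le_five_of_equal_lines_mem_three (u : Fin 5 → Fin 5 → ℂ) (hu : ∀ p q, u p q = u q p) (hu0 : u ≠ 0)
    (V W : Submodule ℂ (Fin 5 → Fin 5 → ℂ)) (hV : ∀ x ∈ V, ∀ p q : Fin 5, x p q = x q p)
    (h3 : Module.finrank ℂ V = 3) (huV : u ∈ V)
    (hWs : ∀ μ ∈ W, ∀ s t : Fin 5, μ s t = μ t s) (hWd : ∀ μ ∈ W, ∀ s : Fin 5, μ s s = 0)
    (hWc : ∀ μ ∈ W, contractZ μ ∈ L3 (ℂ ∙ u) (ℂ ∙ u) V) :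
    Module.finrank ℂ W ≤ 5 := by
  classical
  have hle : (ℂ ∙ u) ≤ V := (Submodule.span_singleton_le_iff_mem u V).mpr huV
  have hXeq : V ⊔ (ℂ ∙ u) = V := sup_eq_left.mpr hle
  have hXeq' : (ℂ ∙ u) ⊔ (ℂ ∙ u) ⊔ V = V := by rw [sup_idem, sup_eq_right.mpr hle]
  have hP4 : Module.finrank ℂ (prolong (V ⊔ (ℂ ∙ u))) ≤ 4 := by
    rw [hXeq]; exact finrank_prolong_le_four V hV h3.le
  have h01 : ∀ x ∈ (ℂ ∙ u), ∀ p q : Fin 5, x p q = x q p := by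
    intro x hx p q
    obtain ⟨s, rfl⟩ := Submodule.mem_span_singleton.mp hx
    simp only [Pi.smul_apply, smul_eq_mul, hu p q]
  -- (d) a diagonal entry
  by_cases hdiag : ∃ p₀, u p₀ p₀ ≠ 0
  · obtain ⟨p₀, hp₀⟩ := hdiag
    have := finrank_le_prolong_add_one_of_diag u hu V W hV hWs hWd hWc p₀ hp₀
    omega
  push Not at hdiag
  -- zero diagonal: a non-zero entry `u i j`, `i ≠ j`
  have hne : ∃ i j, u i j ≠ 0 := by
    by_contra h
    push Not at h
    exact hu0 (funext fun p => funext fun q => h p q)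
  obtain ⟨i, j, hij0⟩ := hne
  have hij : i ≠ j := by rintro rfl; exact hij0 (hdiag i)
  have hji0 : u j i ≠ 0 := by rw [hu]; exact hij0
  by_cases h3r : ∃ p, p ≠ i ∧ p ≠ j ∧ ∃ q, u p q ≠ 0
  · obtain ⟨p, hpi, hpj, q, hpq⟩ := h3r
    by_cases h4r : ∃ p', p' ≠ i ∧ p' ≠ j ∧ p' ≠ p ∧ ∃ q', u p' q' ≠ 0
    · -- four non-zero rows: kernel vectors supported on one letter
      obtain ⟨p', hp'i, hp'j, hp'p, q', hp'q'⟩ := h4r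
      let S : Finset (Fin 5) := (((Finset.univ.erase i).erase j).erase p).erase p'
      have hSc : S.card = 1 := by
        have hj : j ∈ Finset.univ.erase i := Finset.mem_erase.mpr ⟨hij.symm, Finset.mem_univ j⟩
        have hp : p ∈ (Finset.univ.erase i).erase j :=
          Finset.mem_erase.mpr ⟨hpj, Finset.mem_erase.mpr ⟨hpi, Finset.mem_univ p⟩⟩
        have hp' : p' ∈ ((Finset.univ.erase i).erase j).erase p :=
          Finset.mem_erase.mpr ⟨hp'p, Finset.mem_erase.mpr ⟨hp'j, Finset.mem_erase.mpr ⟨hp'i, Finset.mem_univ p'⟩⟩⟩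
        simp only [S, Finset.card_erase_of_mem hp', Finset.card_erase_of_mem hp, Finset.card_erase_of_mem hj,
          Finset.card_erase_of_mem (Finset.mem_univ i), Finset.card_univ, Fintype.card_fin]
      have h := finrank_le_prolong_add_card_of_zeroDiag u hu V W hV hWs hWd hWc hdiag S (fun m hm => by
        by_cases hmi : m = i
        · exact ⟨j, by rw [hmi]; exact hij0⟩
        by_cases hmj : m = j
        · exact ⟨i, by rw [hmj]; exact hji0⟩
        by_cases hmp : m = p
        · exact ⟨q, by rw [hmp]; exact hpq⟩
        by_cases hmp' : m = p'
        · exact ⟨q', by rw [hmp']; exact hp'q'⟩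
        exact absurd (Finset.mem_erase.mpr ⟨hmp', Finset.mem_erase.mpr ⟨hmp, Finset.mem_erase.mpr ⟨hmj,
          Finset.mem_erase.mpr ⟨hmi, Finset.mem_univ m⟩⟩⟩⟩) hm)
      rw [hSc] at h
      omega
    · -- exactly the three rows `i, j, p` are non-zero
      push Not at h4r
      let S : Finset (Fin 5) := ((Finset.univ.erase i).erase j).erase p
      have hj : j ∈ Finset.univ.erase i := Finset.mem_erase.mpr ⟨hij.symm, Finset.mem_univ j⟩
      have hp : p ∈ (Finset.univ.erase i).erase j :=
        Finset.mem_erase.mpr ⟨hpj, Finset.mem_erase.mpr ⟨hpi, Finset.mem_univ p⟩⟩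
      have hSc : S.card = 2 := by
        simp only [S, Finset.card_erase_of_mem hp, Finset.card_erase_of_mem hj, Finset.card_erase_of_mem (Finset.mem_univ i),
          Finset.card_univ, Fintype.card_fin]
      have hmemS : ∀ m, m ∈ S ↔ m ≠ p ∧ m ≠ j ∧ m ≠ i := fun m => by
        simp only [S, Finset.mem_erase, Finset.mem_univ, and_true]
      have hW2 := finrank_le_prolong_add_card_of_zeroDiag u hu V W hV hWs hWd hWc hdiag S (fun m hm => by
        by_cases hmi : m = i
        · exact ⟨j, by rw [hmi]; exact hij0⟩
        by_cases hmj : m = j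
        · exact ⟨i, by rw [hmj]; exact hji0⟩
        by_cases hmp : m = p
        · exact ⟨q, by rw [hmp]; exact hpq⟩
        exact absurd ((hmemS m).mpr ⟨hmp, hmj, hmi⟩) hm)
      rw [hSc] at hW2
      by_cases hP3 : Module.finrank ℂ (prolong (V ⊔ (ℂ ∙ u))) ≤ 3
      · omega
      -- `finrank (prolong V) = 4`: two coordinate slices at the free letters
      obtain ⟨f₁, f₂, hf12, hSeq⟩ := Finset.card_eq_two.mp hSc
      have hf₁ : f₁ ≠ p ∧ f₁ ≠ j ∧ f₁ ≠ i := (hmemS f₁).mp (by rw [hSeq]; simp)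
      have hf₂ : f₂ ≠ p ∧ f₂ ≠ j ∧ f₂ ≠ i := (hmemS f₂).mp (by rw [hSeq]; simp)
      have hcov : ∀ x : Fin 5, x = f₁ ∨ x = f₂ ∨ x = i ∨ x = j ∨ x = p := by
        intro x
        by_cases hx : x ∈ S
        · rw [hSeq, Finset.mem_insert, Finset.mem_singleton] at hx
          rcases hx with h | h
          · exact Or.inl h
          · exact Or.inr (Or.inl h)
        · rw [hmemS] at hx
          push Not at hx
          by_cases hxp : x = p
          · exact Or.inr (Or.inr (Or.inr (Or.inr hxp)))
          by_cases hxj : x = j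
          · exact Or.inr (Or.inr (Or.inr (Or.inl hxj)))
          exact Or.inr (Or.inr (Or.inl (hx hxp hxj)))
      -- the zero pattern of a coordinate slice
      let E : Fin 5 → Fin 5 → ((Fin 5 → Fin 5 → ℂ) →ₗ[ℂ] ℂ) := fun a b =>
        (LinearMap.proj b : (Fin 5 → ℂ) →ₗ[ℂ] ℂ).comp (LinearMap.proj a : (Fin 5 → Fin 5 → ℂ) →ₗ[ℂ] (Fin 5 → ℂ))
      have hE : ∀ a b (M : Fin 5 → Fin 5 → ℂ), E a b M = M a b := fun _ _ _ => rfl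
      let Z : Fin 5 → Submodule ℂ (Fin 5 → Fin 5 → ℂ) := fun c =>
        (⨅ b, LinearMap.ker (E c b)) ⊓ (⨅ b, LinearMap.ker (E b b)) ⊓ (⨅ a, ⨅ b, LinearMap.ker (E a b - E b a))
      have hZ : ∀ c (M : Fin 5 → Fin 5 → ℂ), M ∈ Z c ↔ (∀ b, M c b = 0) ∧ (∀ b, M b b = 0) ∧ (∀ a b, M a b = M b a) := by
        intro c M
        simp only [Z, Submodule.mem_inf, Submodule.mem_iInf, LinearMap.mem_ker, LinearMap.sub_apply, hE, sub_eq_zero, and_assoc]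
      have hslice : ∀ f : Fin 5, f ≠ p ∧ f ≠ j ∧ f ≠ i → ∀ μ ∈ W, (fun a b => contractZ μ a b f) ∈ V ⊓ Z f := by
        rintro f ⟨hfp, hfj, hfi⟩ μ hμ
        have hrow : ∀ x ∈ (ℂ ∙ u), ∀ b : Fin 5, x f b = 0 := by
          intro x hx b
          obtain ⟨s, rfl⟩ := Submodule.mem_span_singleton.mp hx
          simp only [Pi.smul_apply, smul_eq_mul, h4r f hfi hfj hfp b, mul_zero]
        have hm := sliceCoord_mem_01 (ℂ ∙ u) (ℂ ∙ u) V h01 h01 hV f hrow μ (hWc μ hμ)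
        rw [hXeq'] at hm
        refine Submodule.mem_inf.mpr ⟨hm, (hZ f _).mpr ⟨fun b => ?_, fun b => ?_, fun a b => ?_⟩⟩
        · show contractZ μ f b f = 0
          rw [← contractZ_swap23, ← contractZ_swap12]; exact contractZ_rep12 μ f b
        · exact contractZ_rep12 μ b f
        · exact contractZ_swap12 μ b a f
      have hb := finrank_le_of_two_slices W hWs hWd f₁ f₂ i j p hcov (V ⊓ Z f₁) (V ⊓ Z f₂)
        (fun μ hμ => hslice f₁ hf₁ μ hμ) (fun μ hμ => hslice f₂ hf₂ μ hμ)
      -- each slice space has finrank ≤ 2: otherwise `V` is zero-diagonal and `prolong V` would be small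
      have hZle : ∀ f : Fin 5, Module.finrank ℂ (V ⊓ Z f : Submodule ℂ (Fin 5 → Fin 5 → ℂ)) ≤ 2 := by
        intro f
        by_contra hgt
        push Not at hgt
        have hEq : V ⊓ Z f = V :=
          Submodule.eq_of_le_of_finrank_le inf_le_left (by omega)
        have hVd : ∀ x ∈ V, ∀ b : Fin 5, x b b = 0 := by
          intro x hx b
          have hx' : x ∈ V ⊓ Z f := by rw [hEq]; exact hx
          exact ((hZ f x).mp (Submodule.mem_inf.mp hx').2).2.1 b
        have := finrank_prolong_le_three_of_zeroDiag V hVd h3.le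
        rw [hXeq] at hP3
        omega
      have h1 := hZle f₁
      have h2 := hZle f₂
      omega
  · -- only the rows `i, j` are non-zero: a pair-supported line
    push Not at h3r
    obtain ⟨c₁, c₂, c₃, hcov, hc₁, hc₂, hc₃, -, -, -⟩ := exists_three_off_pair i j hij
    have hsupp : ∀ a b, u a b ≠ 0 → (a = i ∨ a = j) ∧ (b = i ∨ b = j) := by
      intro a b hab
      constructor
      · by_contra h
        push Not at h
        exact hab (h3r a h.1 h.2 b)
      · by_contra h
        push Not at h
        rw [hu] at hab
        exact hab (h3r b h.1 h.2 a)
    have hX : Module.finrank ℂ ((ℂ ∙ u) ⊔ (ℂ ∙ u) ⊔ V : Submodule ℂ (Fin 5 → Fin 5 → ℂ)) ≤ 3 := by rw [hXeq', h3]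
    exact finrank_le_five_of_pairLine_flat u hu i j c₁ c₂ c₃ hcov hc₁ hc₂ hc₃ hsupp (ℂ ∙ u) V W h01 hV hX hWs hWd hWc

/-- ★★ **`(SC)` FOR EQUAL LINES INSIDE THEIR 3-SPACE**: `(ℂu, ℂu, V)`, `u ∈ V`, `V` symmetric with `finrank V = 3`. [folklore] -/
theorem captureIneqSym_of_equal_lines_mem_three (u : Fin 5 → Fin 5 → ℂ) (hu : ∀ p q, u p q = u q p) (hu0 : u ≠ 0)
    (V W : Submodule ℂ (Fin 5 → Fin 5 → ℂ)) (hV : ∀ x ∈ V, ∀ p q : Fin 5, x p q = x q p)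
    (h3 : Module.finrank ℂ V = 3) (huV : u ∈ V)
    (hWs : ∀ μ ∈ W, ∀ s t : Fin 5, μ s t = μ t s) (hWd : ∀ μ ∈ W, ∀ s : Fin 5, μ s s = 0)
    (hWc : ∀ μ ∈ W, contractZ μ ∈ L3 (ℂ ∙ u) (ℂ ∙ u) V) :
    Module.finrank ℂ W ≤ Module.finrank ℂ (ℂ ∙ u) + Module.finrank ℂ (ℂ ∙ u) + Module.finrank ℂ V := by
  have h := finrank_le_five_of_equal_lines_mem_three u hu hu0 V W hV h3 huV hWs hWd hWc
  rw [finrank_span_singleton hu0, h3]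
  omega

/-- ★★★ **THE PROFILES `(1,1,r)`, `r ≤ 3`, OF `CaptureIneqSym`.**  `U₀₁ = ℂu₁`, `U₀₂ = ℂu₂` (`u₁, u₂ ≠ 0` symmetric, equal or not),
`U₁₂` symmetric with `finrank U₁₂ ≤ 3`: every captured space `W` of symmetric zero-diagonal leaf matrices has
`finrank W ≤ finrank ℂu₁ + finrank ℂu₂ + finrank U₁₂`. [folklore] -/
theorem captureIneqSym_of_two_lines_le_three (u₁ u₂ : Fin 5 → Fin 5 → ℂ)
    (hu₁ : ∀ p q, u₁ p q = u₁ q p) (hu₂ : ∀ p q, u₂ p q = u₂ q p) (h₁ : u₁ ≠ 0) (h₂ : u₂ ≠ 0)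
    (U12 W : Submodule ℂ (Fin 5 → Fin 5 → ℂ)) (hU12 : ∀ x ∈ U12, ∀ p q : Fin 5, x p q = x q p)
    (hd : Module.finrank ℂ U12 ≤ 3)
    (hWs : ∀ μ ∈ W, ∀ s t : Fin 5, μ s t = μ t s) (hWd : ∀ μ ∈ W, ∀ s : Fin 5, μ s s = 0)
    (hWc : ∀ μ ∈ W, contractZ μ ∈ L3 (ℂ ∙ u₁) (ℂ ∙ u₂) U12) :
    Module.finrank ℂ W ≤ Module.finrank ℂ (ℂ ∙ u₁) + Module.finrank ℂ (ℂ ∙ u₂) + Module.finrank ℂ U12 := by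
  classical
  by_cases hd2 : Module.finrank ℂ U12 ≤ 2
  · exact captureIneqSym_of_two_lines u₁ u₂ hu₁ hu₂ h₁ h₂ U12 W hU12 hd2 hWs hWd hWc
  have hd3 : Module.finrank ℂ U12 = 3 := by omega
  by_cases hmem : u₁ ∈ U12
  · by_cases hnp : ∃ i j k l, u₁ i j * u₂ k l ≠ u₁ k l * u₂ i j
    · exact captureIneqSym_of_nonproportional_lines_any u₁ u₂ hu₁ hu₂ hnp U12 W hU12 hWs hWd hWc
    push Not at hnp
    -- `u₂ = t • u₁`: equal lines inside `U12`
    have hne : ∃ i j, u₁ i j ≠ 0 := by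
      by_contra h
      push Not at h
      exact h₁ (funext fun p => funext fun q => h p q)
    obtain ⟨i₀, j₀, h0⟩ := hne
    set t : ℂ := u₂ i₀ j₀ / u₁ i₀ j₀ with ht
    have hu₂t : u₂ = t • u₁ := by
      funext k l
      simp only [Pi.smul_apply, smul_eq_mul, ht]
      have := hnp i₀ j₀ k l
      field_simp
      linear_combination this
    have htne : t ≠ 0 := by
      intro h0'; apply h₂; rw [hu₂t, h0', zero_smul]
    have hspan : (ℂ ∙ u₂) = (ℂ ∙ u₁) := by
      rw [hu₂t]; exact Submodule.span_singleton_smul_eq (isUnit_iff_ne_zero.mpr htne) u₁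
    rw [hspan] at hWc ⊢
    exact captureIneqSym_of_equal_lines_mem_three u₁ hu₁ h₁ U12 W hU12 hd3 hmem hWs hWd hWc
  · exact captureIneqSym_of_two_lines_any_of_not_mem u₁ u₂ hu₁ hu₂ h₁ h₂ U12 W hU12 hmem hd hWs hWd hWc

end LaplaceFiveSeparatedCapture

end Summit.ValiantsHypothesis.ValiantsHypothesis.Theorems.RigidityForcesSymmetryRankRigidMinimalRepr
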